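import Summits.ValiantsHypothesis.ValiantsHypothesis.Theorems.DefinabilityGapFaceDescent
import HarnessLib

/-!
# The divisibility leaf for the KI generator (sub-road «width», leaf 23704)

Helper file `--supports stmt-ValiantsHypothesis-23704` (`KIPlantedHittingRO`, aside) of route `DefinabilityGap`;
decomposition workshop, lens 5 (hardness–randomness / PIT axis), generation 32. HONEST LABEL: ELEMENTARY ·
new-combination (the H-form `DefinabilityGapRatioLeaf.exists_cofactor` + root extraction in `ℂ[X]` + the shifted
primes `P_c − α` of `DefinabilityGapShiftedPrimes`, whose private seed variables have degree one) ·
K1-currency (read-once width-2 chains) · 0 S-currency · closes no item ·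
decides NOTHING of `RatioLeaf(m)` / full width-2 read-once hitting / `b ≥ 2` / K2 / `KIAnnihilatorDefinableOnCollapse`
/ VP ≠ VNP. Notation: `φ := bind₁ (kiPer m)`, `G_m := kiPer m`, `P_c := G_m(c)`, `E_c := cellEmb m c`.

* §1 ★ THE DIVISIBILITY LEAF (`ratioLeaf_of_divLeaf`, `chainVal_eq_zero_of_divLeaf`). `DivLeaf(m)` — typed here as
  the hypothesis `hDL`, no definition — says: for every block `c`, every read-once width-2 chain `E` with pairwise
  distinct blocks NOT reading `c` (any input and output vectors) and every `α ∈ ℂ`,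
  `(P_c − α) ∣ φ(E) ⟹ φ(E) = 0`; i.e. a nonzero `φ`-image of a read-once width-2 chain avoiding `c` lies in no
  prime ideal `(P_c − α)` (`kiPer_sub_C_prime`) — it vanishes identically on no level hypersurface `{P_c = α}`.
  THEN `RatioLeaf(m)` (`DefinabilityGapRatioLeaf`), hence FULL width-2 read-once hitting at `m` (`m ≥ 1`): a
  violation `A(P_c)·φ(G₀) + B(P_c)·φ(G₁) = 0` has the H-form `φ(G₀) = −B(P_c)·H`, `φ(G₁) = A(P_c)·H`
  (`exists_cofactor`), a non-constant `A` (or `B`) has a root `α` (`Complex.exists_root`), and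
  `(P_c − α) ∣ A(P_c) ∣ φ(G₁)` (`exists_kiPer_sub_C_dvd`). ONE-DIRECTIONAL: `DivLeaf(m)` is formally STRONGER than
  `RatioLeaf(m)` (one column, one linear factor); the converse is not claimed. Since `RatioLeaf(2)` is false
  (`DefinabilityGapWidthTwoAtTwo` with `DefinabilityGapRatioLeaf.ratioLeaf_iff`), so is `DivLeaf(2)`; the open
  range is `m ≥ 3`.
* §2 `kiPer_hits_isROABP_two_of_divLeaf` — the `KIPlantedHittingRO` currency (`w = 2`, every `d`, `π`, `N`).
* §3 ★ THE PRIVATE-CELL RUNG (`bind₁_kiPer_eq_zero_of_dvd_of_private`, `divLeaf_of_private`,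
  `divLeaf_of_length_lt`). If block `c` has a cell `E_c(p)` which is a cell of no block read by `G`, then
  `(P_c − α) ∣ φ(G) ⟹ φ(G) = 0`: the seed `y_{E_c(p)}` has degree `1` in `P_c − α`
  (`degreeOf_perPoly_sub_C`) and degree `0` in `φ(G)`, and degrees add in the domain `ℂ[y]` (`degreeOf_mul_eq`).
  By the design (two blocks share `≤ 2` cells, `DefinabilityGapTopCorner.exists_cell_notMem`) this DECIDES every
  instance of `DivLeaf(m)` in the co-small regime `2·|E| < m²`, all `m`; the open regime of `DivLeaf(m)` is the
  crowded one, exactly as for `RatioLeaf(m)`.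
NON-VACUITY / SHAPE: `hDL` is a plain `∀`-statement over chains — there is no `∃`-binder over a size parameter in
this file; it is not vacuous-admitting: it FAILS at `m = 2` (the annihilated nonzero read-once width-2 family of
`DefinabilityGapWidthTwoAtTwo`, by §1) and HOLDS on every co-small instance (§3). RESIDUAL after this file,
IDEA-NEEDED and untouched: cell (β″) of `DefinabilityGapFaceDescent`, readable through §1 as «a DivLeaf violation:
a crowded (`2·|E| ≥ m²`) read-once width-2 chain `E` not reading `c` with `0 ≠ φ(E) ∈ (P_c − α)`»; no explicit
undecided member is known for `m ≥ 3`.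
[cite: KabanetsImpagliazzo2003, Lemma 30] [cite: SahaSaptharishiSaxena2009, Lemma 2.1]
-/
noncomputable section
set_option linter.dupNamespace false
open MvPolynomial
open Literature.Computability.AlgebraicComplexity Literature.Computability.MetaComplexity
open scoped Polynomial

namespace Summit.ValiantsHypothesis.ValiantsHypothesis.Theorems.DefinabilityGapDivisibilityLeaf
open Summit.ValiantsHypothesis.ValiantsHypothesis.Theorems.DefinabilityGapAffineRung
open Summit.ValiantsHypothesis.ValiantsHypothesis.Theorems.DefinabilityGapShiftedPrimes
open Summit.ValiantsHypothesis.ValiantsHypothesis.Theorems.DefinabilityGapAxisSubstitution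
open Summit.ValiantsHypothesis.ValiantsHypothesis.Theorems.DefinabilityGapZperTransfer
open Summit.ValiantsHypothesis.ValiantsHypothesis.Theorems.DefinabilityGapRatioLeaf
open Summit.ValiantsHypothesis.ValiantsHypothesis.Theorems.DefinabilityGapTopCorner
open Summit.ValiantsHypothesis.ValiantsHypothesis.Theorems.DefinabilityGapFaceDescent

variable {m : ℕ}

/-! ## 1. The divisibility leaf implies the ratio leaf -/

/-- **ROOT EXTRACTION**: if `E(P_c) ∣ F` for a non-constant univariate `E`, then `(P_c − α) ∣ F` for a root `α` of
`E` (fundamental theorem of algebra; `aeval (P_c)` is a ring map). [folklore] -/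
theorem exists_kiPer_sub_C_dvd (c : Fin 3 → Fin (qOf m)) {E : ℂ[X]} (hE : 0 < E.natDegree)
    {F : MvPolynomial (Fin (qOf m) × Fin (qOf m)) ℂ} (hF : Polynomial.aeval (kiPer m c) E ∣ F) :
    ∃ α : ℂ, kiPer m c - C α ∣ F := by
  obtain ⟨α, hα⟩ := Complex.exists_root (Polynomial.natDegree_pos_iff_degree_pos.1 hE)
  refine ⟨α, dvd_trans ?_ hF⟩
  have hev : Polynomial.aeval (kiPer m c) (Polynomial.X - Polynomial.C α) = kiPer m c - C α := by
    rw [map_sub, Polynomial.aeval_X, Polynomial.aeval_C, MvPolynomial.algebraMap_eq]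
  rw [← hev]
  exact map_dvd (Polynomial.aeval (kiPer m c)) (Polynomial.dvd_iff_isRoot.2 hα)

/-- ★ **THE RATIO LEAF FROM THE DIVISIBILITY LEAF** (`m ≥ 1`): if for every block `c`, every read-once width-2
chain `E` with pairwise distinct blocks not reading `c` and every `α`, `(P_c − α) ∣ φ(E)` forces `φ(E) = 0`
(hypothesis `hDL` = `DivLeaf(m)`), then `RatioLeaf(m)` — literally the left-hand side of
`DefinabilityGapRatioLeaf.ratioLeaf_iff`. H-form of a violation, a root of the non-constant column multiplier, the
divisibility `(P_c − α) ∣ A(P_c) ∣ φ(G₁)`, then `H = 0` in the domain. ELEMENTARY · new-combination · K1-currency ·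
one-directional (`DivLeaf(m)` is formally stronger; converse not claimed) · 0 S-currency · decides NOTHING of
`RatioLeaf(m)` / full width 2 / `b ≥ 2` / K2 / VP ≠ VNP · residual (β″) stated in the module docstring. [this file] -/
theorem ratioLeaf_of_divLeaf (hm : 1 ≤ m)
    (hDL : ∀ (c : Fin 3 → Fin (qOf m)) (rest : List (W2Link m)), (rest.map W2Link.blk).Nodup →
      c ∉ rest.map W2Link.blk → ∀ (u v : Fin 2 → ℂ) (α : ℂ),
      kiPer m c - C α ∣ bind₁ (kiPer m) (chainVal (rest.map W2Link.mat) u v) →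
        bind₁ (kiPer m) (chainVal (rest.map W2Link.mat) u v) = 0) :
    ∀ (c : Fin 3 → Fin (qOf m)) (rest : List (W2Link m)), (rest.map W2Link.blk).Nodup →
      c ∉ rest.map W2Link.blk → ∀ (v : Fin 2 → ℂ) (A B : ℂ[X]), IsCoprime A B → (0 < A.natDegree ∨ 0 < B.natDegree) →
      Polynomial.aeval (kiPer m c) A * bind₁ (kiPer m) (chainVal (rest.map W2Link.mat) (Pi.single 0 1) v) +
          Polynomial.aeval (kiPer m c) B * bind₁ (kiPer m) (chainVal (rest.map W2Link.mat) (Pi.single 1 1) v) = 0 →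
        bind₁ (kiPer m) (chainVal (rest.map W2Link.mat) (Pi.single 0 1) v) = 0 ∧
          bind₁ (kiPer m) (chainVal (rest.map W2Link.mat) (Pi.single 1 1) v) = 0 := by
  intro c rest hnd hc v A B hcop hdeg h
  obtain ⟨H, hF₀, hF₁⟩ := exists_cofactor hm c hcop h
  rcases hdeg with hA | hB
  · have hA0 : A ≠ 0 := by
      rintro rfl
      rw [Polynomial.natDegree_zero] at hA
      exact lt_irrefl 0 hA
    have hdv : Polynomial.aeval (kiPer m c) A ∣
        bind₁ (kiPer m) (chainVal (rest.map W2Link.mat) (Pi.single 1 1) v) := Dvd.intro H hF₁.symm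
    obtain ⟨α, hα⟩ := exists_kiPer_sub_C_dvd c hA hdv
    have h1 : bind₁ (kiPer m) (chainVal (rest.map W2Link.mat) (Pi.single 1 1) v) = 0 :=
      hDL c rest hnd hc (Pi.single 1 1) v α hα
    have hH : H = 0 :=
      (mul_eq_zero.1 (hF₁.symm.trans h1)).resolve_left (aeval_kiPer_ne_zero hm c hA0)
    refine ⟨?_, h1⟩
    rw [hF₀, hH, mul_zero]
  · have hB0 : B ≠ 0 := by
      rintro rfl
      rw [Polynomial.natDegree_zero] at hB
      exact lt_irrefl 0 hB
    have hdv : Polynomial.aeval (kiPer m c) B ∣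
        bind₁ (kiPer m) (chainVal (rest.map W2Link.mat) (Pi.single 0 1) v) :=
      Dvd.intro (-H) (by rw [mul_neg, ← neg_mul]; exact hF₀.symm)
    obtain ⟨β, hβ⟩ := exists_kiPer_sub_C_dvd c hB hdv
    have h0 : bind₁ (kiPer m) (chainVal (rest.map W2Link.mat) (Pi.single 0 1) v) = 0 :=
      hDL c rest hnd hc (Pi.single 0 1) v β hβ
    have hH : H = 0 := by
      have h2 : -(Polynomial.aeval (kiPer m c) B) * H = 0 := hF₀.symm.trans h0
      rw [neg_mul, neg_eq_zero] at h2
      exact (mul_eq_zero.1 h2).resolve_left (aeval_kiPer_ne_zero hm c hB0)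
    refine ⟨h0, ?_⟩
    rw [hF₁, hH, mul_zero]

/-- ★ **FULL WIDTH-2 READ-ONCE HITTING FROM THE DIVISIBILITY LEAF** (`m ≥ 1`): under `DivLeaf(m)`,
`φ = bind₁ (kiPer m)` annihilates no nonzero read-once width-2 block chain — §1 composed with
`DefinabilityGapRatioLeaf.chainVal_eq_zero_of_ratioLeaf`. ELEMENTARY · K1-currency · one-directional · 0 S-currency ·
decides NOTHING of `RatioLeaf(m)` / full width 2 / `b ≥ 2` / K2 / VP ≠ VNP. [this file] -/
theorem chainVal_eq_zero_of_divLeaf (hm : 1 ≤ m)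
    (hDL : ∀ (c : Fin 3 → Fin (qOf m)) (rest : List (W2Link m)), (rest.map W2Link.blk).Nodup →
      c ∉ rest.map W2Link.blk → ∀ (u v : Fin 2 → ℂ) (α : ℂ),
      kiPer m c - C α ∣ bind₁ (kiPer m) (chainVal (rest.map W2Link.mat) u v) →
        bind₁ (kiPer m) (chainVal (rest.map W2Link.mat) u v) = 0) :
    ∀ l : List (W2Link m), (l.map W2Link.blk).Nodup → ∀ u v : Fin 2 → ℂ,
      bind₁ (kiPer m) (chainVal (l.map W2Link.mat) u v) = 0 → chainVal (l.map W2Link.mat) u v = 0 :=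
  chainVal_eq_zero_of_ratioLeaf hm (ratioLeaf_of_divLeaf hm hDL)

/-! ## 2. The `KIPlantedHittingRO` currency -/

/-- **FULL WIDTH 2 OF `KIPlantedHittingRO` FROM `DivLeaf(m)`** (`w = 2`, every degree `d`, every variable order
`π`, every length `N`). [this file] -/
theorem kiPer_hits_isROABP_two_of_divLeaf (hm : 1 ≤ m)
    (hDL : ∀ (c : Fin 3 → Fin (qOf m)) (rest : List (W2Link m)), (rest.map W2Link.blk).Nodup →
      c ∉ rest.map W2Link.blk → ∀ (u v : Fin 2 → ℂ) (α : ℂ),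
      kiPer m c - C α ∣ bind₁ (kiPer m) (chainVal (rest.map W2Link.mat) u v) →
        bind₁ (kiPer m) (chainVal (rest.map W2Link.mat) u v) = 0)
    {N d : ℕ} (π : Fin N ≃ (Fin 3 → Fin (qOf m))) (D : MvPolynomial (Fin 3 → Fin (qOf m)) ℂ) (hD : D ≠ 0)
    (hR : IsROABP ℂ 2 d π D) : bind₁ (kiPer m) D ≠ 0 :=
  kiPer_hits_isROABP_two_of_ratioLeaf hm (ratioLeaf_of_divLeaf hm hDL) π D hD hR

/-! ## 3. The private-cell rung: `DivLeaf(m)` in the co-small regime -/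

/-- ★ **THE PRIVATE-CELL RUNG** (`m ≥ 1`, any `G`): if the cell `E_c(p)` of block `c` is a cell of no block read
by `G`, then `(P_c − α) ∣ φ(G)` forces `φ(G) = 0` — the seed `y_{E_c(p)}` has degree `1` in the prime `P_c − α`
and degree `0` in `φ(G)`, and degrees add in the domain `ℂ[y]`. ELEMENTARY · K1-currency · decides the co-small
instances of `DivLeaf(m)` only · 0 S-currency · decides NOTHING of `RatioLeaf(m)` / full width 2 / `b ≥ 2` / K2 /
VP ≠ VNP. [this file] -/
theorem bind₁_kiPer_eq_zero_of_dvd_of_private (hm : 1 ≤ m) (c : Fin 3 → Fin (qOf m)) (p : Fin m × Fin m)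
    {G : MvPolynomial (Fin 3 → Fin (qOf m)) ℂ}
    (hp : ∀ j ∈ G.vars, cellEmb m c p ∉ Finset.univ.map (cellEmb m j)) (α : ℂ)
    (hdvd : kiPer m c - C α ∣ bind₁ (kiPer m) G) : bind₁ (kiPer m) G = 0 := by
  classical
  obtain ⟨H, hH⟩ := hdvd
  by_contra hG
  have hH0 : H ≠ 0 := fun h0 => hG (by rw [hH, h0, mul_zero])
  have hP0 : kiPer m c - C α ≠ 0 := (kiPer_sub_C_prime hm c α).ne_zero
  have hx : cellEmb m c p ∉ (bind₁ (kiPer m) G).vars := fun hx => by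
    obtain ⟨j, hj, hxj⟩ := Finset.mem_biUnion.1 (vars_bind₁ (kiPer m) G hx)
    rw [kiPer_eq_rename_cellEmb] at hxj
    obtain ⟨p', -, hp'⟩ := Finset.mem_image.1 (vars_rename _ _ hxj)
    exact hp j hj (Finset.mem_map.2 ⟨p', Finset.mem_univ _, hp'⟩)
  have h0 : degreeOf (cellEmb m c p) (bind₁ (kiPer m) G) = 0 := by
    by_contra h
    exact hx (mem_vars_iff_degreeOf_ne_zero.2 h)
  have h1 : degreeOf (cellEmb m c p) (kiPer m c - C α) = 1 := by
    haveI : Nonempty (Fin m) := ⟨⟨0, hm⟩⟩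
    rw [kiPer_sub_C_eq_rename, degreeOf_rename_of_injective (cellEmb m c).injective]
    exact degreeOf_perPoly_sub_C α p
  rw [hH, degreeOf_mul_eq hP0 hH0, h1] at h0
  omega

/-- **`DivLeaf(m)` AT A CHAIN WITH A PRIVATE CELL**: if `E_c(p)` is a cell of no block of the read-once chain
`rest`, then `(P_c − α) ∣ φ(value of rest) ⟹ φ(value of rest) = 0`, for all input/output vectors. [this file] -/
theorem divLeaf_of_private (hm : 1 ≤ m) (c : Fin 3 → Fin (qOf m)) (rest : List (W2Link m))
    (p : Fin m × Fin m) (hp : ∀ L ∈ rest, cellEmb m c p ∉ Finset.univ.map (cellEmb m L.blk))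
    (u v : Fin 2 → ℂ) (α : ℂ) (hdvd : kiPer m c - C α ∣ bind₁ (kiPer m) (chainVal (rest.map W2Link.mat) u v)) :
    bind₁ (kiPer m) (chainVal (rest.map W2Link.mat) u v) = 0 := by
  refine bind₁_kiPer_eq_zero_of_dvd_of_private hm c p (fun j hj => ?_) α hdvd
  have hj' : j ∈ rest.map W2Link.blk :=
    mem_supported.1 (chainVal_mem_supported rest u v) (Finset.mem_coe.2 hj)
  obtain ⟨L, hL, rfl⟩ := List.mem_map.1 hj'
  exact hp L hL

/-- **`DivLeaf(m)` IN THE CO-SMALL REGIME** (all `m ≥ 1`): a read-once chain `rest` not reading `c` with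
`2·|rest| < m²` leaves `c` a private cell (two blocks share `≤ 2` cells), so every instance of `DivLeaf(m)` at
`(c, rest)` holds; the open regime of `DivLeaf(m)` is the crowded one. [this file] -/
theorem divLeaf_of_length_lt (hm : 1 ≤ m) (c : Fin 3 → Fin (qOf m)) (rest : List (W2Link m))
    (hc : c ∉ rest.map W2Link.blk) (hlen : 2 * rest.length < m * m) (u v : Fin 2 → ℂ) (α : ℂ)
    (hdvd : kiPer m c - C α ∣ bind₁ (kiPer m) (chainVal (rest.map W2Link.mat) u v)) :
    bind₁ (kiPer m) (chainVal (rest.map W2Link.mat) u v) = 0 := by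
  classical
  have hcJ : c ∉ (rest.map W2Link.blk).toFinset := fun h => hc (List.mem_toFinset.1 h)
  have hcard : (rest.map W2Link.blk).toFinset.card ≤ rest.length :=
    (List.toFinset_card_le _).trans (by simp)
  have hJ : 2 * (rest.map W2Link.blk).toFinset.card < m * m := by omega
  obtain ⟨p, hp⟩ := exists_cell_notMem m hcJ hJ
  exact divLeaf_of_private hm c rest p
    (fun L hL => hp L.blk (List.mem_toFinset.2 (List.mem_map.2 ⟨L, hL, rfl⟩))) u v α hdvd

end Summit.ValiantsHypothesis.ValiantsHypothesis.Theorems.DefinabilityGapDivisibilityLeaf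

end
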